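import Summits.QuantumFields.YangMills.Theorems.TwistEaterVolumeQuadraticGrowthQuaternion
import HarnessLib

/-!
# Conjugacy of pure orthonormal pairs of unit quaternions (SO(3) acts transitively on orthonormal 2-frames)
# (layer (B1b) tail of the DIRECT Laplace road to ⟨stmt-QuantumFields-24204⟩ `VirialFluxGap.SharpTwistedLaplace`)

Helper module (free-hands work of width seat ym-line-sfw-p2-w2 g49, cell ym-idea-1).  With ✓`twistEater_structure` every SU(2) twist-eater
is determined by a pure orthonormal pair `(n, a)` and signs; this file shows that all pure orthonormal pairs are conjugate (so the zero set of
the twisted deficit is a union of FOUR gauge orbits, one per sign class): ★ `exists_unit_conj_basis_eq` — for pure unit quaternions `n ⊥ a` there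
is a unit quaternion `q` with `q K q⁻¹ = n` and `q I q⁻¹ = a` (`I = (0,1,0,0)`, `K = (0,0,0,1)`); ★ `exists_unit_conj_pair_eq` — any two pure
orthonormal pairs are conjugate.  Two-step construction `q = q₁q₂`, `q₁ = 1 − nK` (rotating `K` to `n`), `q₂ = 1 − a′I ∈ span(1, K)`.
Everything here is PROVED; no definitions, no named facts.  HONEST FRAMING: elementary algebra in `ℍ`; ⟨24204⟩, ⟨24319⟩ and every rung stay OPEN;
the Yang–Mills mass gap (Clay) is NOT touched; no summit is proved by a line.
-/

set_option autoImplicit false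

noncomputable section

open scoped Quaternion

namespace Summit.QuantumFields.YangMills.Theorems.QuantitativeLaplace

open Summit.QuantumFields.YangMills.Theorems.ToronValleyVolume.Lojasiewicz
open Summit.QuantumFields.YangMills.Theorems.TwistEaterVolume.Quadratic

/-! ## §1 The key intertwining identity `(1 − p t) t = p (1 − p t)` for pure unit `p, t` -/

/-- A pure unit quaternion squares to `−1`. [folklore] -/
theorem pure_unit_mul_self {t : ℍ} (ht : ‖t‖ = 1) (htre : t.re = 0) : t * t = -1 := by
  have h1 := imDot_eq_one_of_pure' ht htre
  ext <;> simp [htre] <;> nlinarith [h1]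
where
  /-- local copy: `|Im t|² = 1` for a pure unit quaternion. [folklore] -/
  imDot_eq_one_of_pure' {u : ℍ} (hu : ‖u‖ = 1) (hure : u.re = 0) :
      u.imI * u.imI + u.imJ * u.imJ + u.imK * u.imK = 1 := by
    have := norm_sq_eq_re_sq_add_imDot u
    rw [hu, hure] at this
    linarith [this]

/-- ★ The intertwiner: for pure unit `p, t`, `q = 1 − p t` satisfies `q t = p q`. [folklore] -/
theorem intertwine_of_pure_unit {p t : ℍ} (hp : ‖p‖ = 1) (hpre : p.re = 0) (ht : ‖t‖ = 1) (htre : t.re = 0) :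
    (1 - p * t) * t = p * (1 - p * t) := by
  rw [sub_mul, one_mul, mul_assoc, pure_unit_mul_self ht htre, mul_sub, mul_one, ← mul_assoc, pure_unit_mul_self hp hpre]
  simp [add_comm]

/-- `1 − p t = 0` forces `p = −t` (pure unit `t`). [folklore] -/
theorem eq_neg_of_one_sub_mul_eq_zero {p t : ℍ} (ht : ‖t‖ = 1) (htre : t.re = 0) (h : 1 - p * t = 0) : p = -t := by
  have h1 : p * t = 1 := by rw [sub_eq_zero] at h; exact h.symm
  have h2 : p * t * t = t := by rw [h1, one_mul]
  rw [mul_assoc, pure_unit_mul_self ht htre, mul_neg, mul_one] at h2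
  rw [← h2, neg_neg]

/-! ## §2 Rotating `K` to `n`, then `I` to `a` about `K`

The basis quaternions enter as variables `I K : ℍ` with `I = ⟨0,1,0,0⟩`, `K = ⟨0,0,0,1⟩` (so that all products are typed in `ℍ`). -/

/-- For PURE `x, y`: `re(xy) = −(Im x · Im y)`. [folklore] -/
theorem re_mul_of_pure {x y : ℍ} (hx : x.re = 0) (hy : y.re = 0) :
    (x * y).re = -(x.imI * y.imI + x.imJ * y.imJ + x.imK * y.imK) := by
  simp only [Quaternion.re_mul, hx, hy]; ring

/-- Step 1: a non-zero `q₁` with `q₁ K = n q₁` for every pure unit `n`. [folklore] -/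
theorem exists_intertwine_K {I K : ℍ} (hI : I = ⟨0, 1, 0, 0⟩) (hK : K = ⟨0, 0, 0, 1⟩) {n : ℍ} (hn : ‖n‖ = 1) (hnre : n.re = 0) :
    ∃ q : ℍ, q ≠ 0 ∧ q * K = n * q := by
  have hK1 : ‖K‖ = 1 := norm_eq_one_of_components (by rw [hK]; norm_num)
  have hKre : K.re = 0 := by rw [hK]
  by_cases h : (1 : ℍ) - n * K = 0
  · -- `n = −K`: take `q = I`
    have hn' : n = -K := eq_neg_of_one_sub_mul_eq_zero hK1 hKre h
    refine ⟨I, ?_, ?_⟩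
    · intro h0; have := congrArg QuaternionAlgebra.imI h0; rw [hI] at this; simp at this
    · rw [hn', hI, hK]; ext <;> simp
  · exact ⟨1 - n * K, h, intertwine_of_pure_unit hn hnre hK1 hKre⟩

/-- Step 2: for a pure unit `a'` orthogonal to `K` (`a'.imK = 0`), a non-zero `q₂ ∈ span(1, K)` with `q₂ I = a' q₂` and `q₂ K = K q₂`. [folklore] -/
theorem exists_intertwine_I_fix_K {I K : ℍ} (hI : I = ⟨0, 1, 0, 0⟩) (hK : K = ⟨0, 0, 0, 1⟩) {a' : ℍ} (ha : ‖a'‖ = 1)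
    (hare : a'.re = 0) (haK : a'.imK = 0) :
    ∃ q : ℍ, q ≠ 0 ∧ q * I = a' * q ∧ q * K = K * q := by
  have hI1 : ‖I‖ = 1 := norm_eq_one_of_components (by rw [hI]; norm_num)
  have hIre : I.re = 0 := by rw [hI]
  by_cases h : (1 : ℍ) - a' * I = 0
  · -- `a' = −I`: take `q = K`
    have ha2 : a' = -I := eq_neg_of_one_sub_mul_eq_zero hI1 hIre h
    refine ⟨K, ?_, ?_, rfl⟩
    · intro h0; have := congrArg QuaternionAlgebra.imK h0; rw [hK] at this; simp at this
    · rw [ha2, hI, hK]; ext <;> simp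
  · refine ⟨1 - a' * I, h, intertwine_of_pure_unit ha hare hI1 hIre, ?_⟩
    -- `1 − a'I ∈ span(1, K)`, which is commutative
    rw [hI, hK]; ext <;> simp [hare, haK]

/-- Conjugation preserves the norm. [folklore] -/
theorem norm_conj_eq {q x : ℍ} (hq : q ≠ 0) : ‖q⁻¹ * x * q‖ = ‖x‖ := by
  rw [norm_mul, norm_mul, norm_inv]
  have hq' : ‖q‖ ≠ 0 := norm_ne_zero_iff.mpr hq
  field_simp

/-- Conjugation preserves the real part. [folklore] -/
theorem re_conj_eq {q x : ℍ} (hq : q ≠ 0) : (q⁻¹ * x * q).re = x.re := by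
  have hre : ∀ y w : ℍ, (y * w).re = (w * y).re := fun y w => by simp only [Quaternion.re_mul]; ring
  rw [hre, ← mul_assoc, mul_inv_cancel₀ hq, one_mul]

/-- ★ **SO(3) is transitive on orthonormal 2-frames, quaternion form**: for pure unit quaternions `n ⊥ a` there is a UNIT quaternion `u`
with `u K u⁻¹ = n` and `u I u⁻¹ = a`. [folklore] -/
theorem exists_unit_conj_basis_eq {I K : ℍ} (hI : I = ⟨0, 1, 0, 0⟩) (hK : K = ⟨0, 0, 0, 1⟩)
    {n a : ℍ} (hn : ‖n‖ = 1) (hnre : n.re = 0) (ha : ‖a‖ = 1) (hare : a.re = 0)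
    (hperp : n.imI * a.imI + n.imJ * a.imJ + n.imK * a.imK = 0) :
    ∃ u : ℍ, ‖u‖ = 1 ∧ u * K * u⁻¹ = n ∧ u * I * u⁻¹ = a := by
  have hKre : K.re = 0 := by rw [hK]
  obtain ⟨q₁, hq₁, h1⟩ := exists_intertwine_K hI hK hn hnre
  set a' : ℍ := q₁⁻¹ * a * q₁ with ha'
  have ha'1 : ‖a'‖ = 1 := by rw [ha', norm_conj_eq hq₁, ha]
  have ha're : a'.re = 0 := by rw [ha', re_conj_eq hq₁, hare]
  have ha'K : a'.imK = 0 := by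
    have e1 : (a' * K).re = -a'.imK := by
      rw [re_mul_of_pure ha're hKre, hK]; simp
    have e2 : a' * K = q₁⁻¹ * (a * n) * q₁ := by
      rw [ha', mul_assoc, h1]; simp only [mul_assoc]
    have e3 : (a' * K).re = 0 := by
      rw [e2, re_conj_eq hq₁, re_mul_of_pure hare hnre]
      linarith [hperp]
    linarith
  obtain ⟨q₂, hq₂, h2I, h2K⟩ := exists_intertwine_I_fix_K hI hK ha'1 ha're ha'K
  set q : ℍ := q₁ * q₂ with hq
  have hq0 : q ≠ 0 := mul_ne_zero hq₁ hq₂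
  have hqK : q * K = n * q := by
    rw [hq, mul_assoc, h2K, ← mul_assoc, h1, mul_assoc]
  have hqI : q * I = a * q := by
    rw [hq, mul_assoc, h2I, ha']
    simp only [← mul_assoc, mul_inv_cancel₀ hq₁, one_mul]
  have hqn : ‖q‖ ≠ 0 := norm_ne_zero_iff.mpr hq0
  have hu0 : ((‖q‖⁻¹ : ℝ) • q) ≠ 0 := smul_ne_zero (inv_ne_zero hqn) hq0
  refine ⟨(‖q‖⁻¹ : ℝ) • q, ?_, ?_, ?_⟩
  · rw [norm_smul, norm_inv, norm_norm, inv_mul_cancel₀ hqn]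
  · rw [smul_mul_assoc, hqK, ← mul_smul_comm, mul_assoc, mul_inv_cancel₀ hu0, mul_one]
  · rw [smul_mul_assoc, hqI, ← mul_smul_comm, mul_assoc, mul_inv_cancel₀ hu0, mul_one]

/-- ★ **Any two pure orthonormal pairs are conjugate by a unit quaternion.** [folklore] -/
theorem exists_unit_conj_pair_eq {n a n' a' : ℍ} (hn : ‖n‖ = 1) (hnre : n.re = 0) (ha : ‖a‖ = 1) (hare : a.re = 0)
    (hperp : n.imI * a.imI + n.imJ * a.imJ + n.imK * a.imK = 0)
    (hn' : ‖n'‖ = 1) (hn're : n'.re = 0) (ha' : ‖a'‖ = 1) (ha're : a'.re = 0)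
    (hperp' : n'.imI * a'.imI + n'.imJ * a'.imJ + n'.imK * a'.imK = 0) :
    ∃ u : ℍ, ‖u‖ = 1 ∧ u * n * u⁻¹ = n' ∧ u * a * u⁻¹ = a' := by
  set I : ℍ := ⟨0, 1, 0, 0⟩ with hI
  set K : ℍ := ⟨0, 0, 0, 1⟩ with hK
  obtain ⟨u, hu, huK, huI⟩ := exists_unit_conj_basis_eq hI hK hn hnre ha hare hperp
  obtain ⟨v, hv, hvK, hvI⟩ := exists_unit_conj_basis_eq hI hK hn' hn're ha' ha're hperp'
  have hu0 : u ≠ 0 := by intro h; rw [h, norm_zero] at hu; exact zero_ne_one hu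
  refine ⟨v * u⁻¹, ?_, ?_, ?_⟩
  · rw [norm_mul, norm_inv, hu, hv, inv_one, mul_one]
  · rw [← huK, mul_inv_rev, inv_inv]
    calc v * u⁻¹ * (u * K * u⁻¹) * (u * v⁻¹) = v * (u⁻¹ * u) * K * (u⁻¹ * u) * v⁻¹ := by simp only [mul_assoc]
      _ = n' := by rw [inv_mul_cancel₀ hu0, mul_one, mul_one, hvK]
  · rw [← huI, mul_inv_rev, inv_inv]
    calc v * u⁻¹ * (u * I * u⁻¹) * (u * v⁻¹) = v * (u⁻¹ * u) * I * (u⁻¹ * u) * v⁻¹ := by simp only [mul_assoc]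
      _ = a' := by rw [inv_mul_cancel₀ hu0, mul_one, mul_one, hvI]

end Summit.QuantumFields.YangMills.Theorems.QuantitativeLaplace
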